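import Literature.NumberTheory.Rogawski1990.UnitOrbitalIntegralInertValueThetaZeroClosed   -- ★ Flicker a₀ closed forms `natCard_fixedPoints_unitaryInt_flickerTorusOne_eq_phiZero_of_bridge` (θ̄ = 0; brings ★ `…ThetaOneClosed`:
                                                                                         --   `natCard_fixedPoints_unitaryInt_flickerTorus_eq_phiOne_of_bridge`, θ̄ = 1), `phiZero`, `phiOne`, `flickerPH`, `flickerHK`, `LocalConjDatum`
import Summits.HodgeConjecture.HodgeConjecture.Theorems.R90S6GLCosetLatticeDict          -- ★ W7-f (i) `mem_glInt_iff_isIntMatrix` (`GL₃(𝒪)` in the lattice files' currency; brings `glInt`, the Valued∕ValuativeRel bridge)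
import HarnessLib

/-!
# R90 · S6 «Ch. 14.1–14.5 stable trace formula» — card GF1 FILE 2b, FILE 0: THE HYPERSPECIAL COLUMN `V₀(tᵢ) = #Fix_{tᵢ}(U ⧸ K₀)` OF FLICKER'S LITERALS, ALL DEPTH
# REGIMES AT ONCE — `V₀(t_ϖ(a,b,c)) = φ₁(q; N₊, N)`, `V₀(t_1(a,b,c)) = φ₀(q; N₁, N₂, N)` (`Theorems/R90S6TreeFixDataFlickerU3Hyp.lean`)

Cell `hodgecm-mathlib`, crux H413 (`stmt-HodgeConjecture-24833`), route of record `HCCMUnconditional`; programme R90-TF (brief `director/R90-BRIEF.v2.md`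
1f40d54518340a35), section S6 (base `R90-C14`, dealer R90-C14-plan (g2)), seat R90-C14-p10 (g2); card GF1 FILE 2 CO-PEN (dealer 02:42:16Z, cut by the pen-holder
K2Liu-p14 (g5) 02:49:55Z: 2a = generic coset → tree plumbing `R90S6TreeFixDataCosetShellsU3`, 2b (this seat) = per-literal VALUES).  Lane
`--kind proof --supports stmt-HodgeConjecture-24833 --as helper`; THEOREMS ONLY (no definition, no instance, no notation, no named fact, no kit, no `sorry`); imports =
★ Literature `UnitOrbitalIntegralInertValueThetaZeroClosed` (⊇ `…ThetaOneClosed`) + ★ W7-f (i) `Theorems/R90S6GLCosetLatticeDict` + HarnessLib (never `Lines/`).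

THE ROW (E1.3.5.2.6, typ1's (E1) sheet v1.1 b34a1458): the G-side of the elliptic κ-identity for the unramified `E¹`-type needs, per Flicker literal
`t₁ = t_1(a,b,c)`, `t₂ = t_ϖ(a,b,c)`, `t₃ = t_ϖ(a,c,b)`, `t₄ = t_ϖ(b,a,c)`, the displacement shells of the `U(2,1)` tree, which ★ W8-f ∕ ★ G3-NUMBERS ∕ ★ GF1 FILE 1 ∕ 2a
reduce to the two FIXED-VERTEX COUNTS `V₀(tᵢ) = #Fix_{tᵢ}(U ⧸ K₀)` (hyperspecial) and `V₁(tᵢ) = #Fix_{tᵢ}(U ⧸ K₁)` (special).  THIS FILE = the `V₀` column for ALL depth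
data at once: the ★ Flicker closed forms [Flicker1998UnitaryFL, Prop. 11 p. 87 (θ̄ = 1), Prop. 14 p. 94 (θ̄ = 0)] are stated in the tree on `{x : U ⧸ unitaryInt σ J | t·x = x}`
(F0P3 LAYER C), and are re-read here in the GF1 ∕ ★ G1-rung coset currency `Nat.card (fixedBy (U ⧸ (GL₃(𝒪) ⊓ U)) γ)` with the (E1) sheet's literal bytes:
* §1 (H.0) **`flickerFix_natCard_fixedBy_glInt_eq_natCard_smul_unitaryInt`** — the two coset currencies agree: `(glInt N K).subgroupOf U = unitaryInt σ J` entrywise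
  (★ `mem_glInt_iff_isIntMatrix`, ★ `mem_unitaryInt_iff`), any `N`, any form `J`;
* §1 (H.3) **`flickerFix_thetaZero_caseTag`** — the case tag `(N₁ < N ∧ N₂ = N₁ ∧ N₊ = N₁) ∨ (N ≤ N₁ ∧ N ≤ N₊)` of the θ̄ = 0 head ALWAYS holds for the depth letters
  `|a − c| = |ϖ^N|`, `|a + c − 2b| = |ϖ^{N₊}|`, `|a − b| = |ϖ^{N₁}|`, `|c − b| = |ϖ^{N₂}|` when `|2| = 1` (ultrametric bookkeeping; it is not a restriction on the datum);
* §2 (H.1) **`flickerFix_natCard_fixedBy_hyp_tpi`** — `V₀(t_ϖ(a,b,c)) = phiOne q N₊ N` in `ℚ` (★ θ̄ = 1 head; the centraliser letter `htH` and the finiteness letter `hfin`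
  DISCHARGED from the literal and from GF1's `[Fintype (fixedBy (U ⧸ K₀) γ)]`; the rest of the ★ a₀ frame — `LocalConjDatum`, completeness, the (F3c-γ) lattice bridge
  `(R, ι, σR, dR, ϖR)`, `y`, `c = diag(1,−1,1)`, `u_m`, `r_i`, `a₀`, `q` — carried VERBATIM, exactly as ★ G1 rung 2 (C) `natCard_fixedBy_special_add_phiTHn_eq_of_typeTwo` does);
  `t₃, t₄` are this head with the letters `(a,b,c)` permuted to `(a,c,b)`, `(b,a,c)` (the sheet's `hγ₃`, `hγ₄` bytes);
* §2 (H.2) **`flickerFix_natCard_fixedBy_hyp_tOne`** — `V₀(t_1(a,b,c)) = phiZero q N₁ N₂ N` in `ℚ` (★ θ̄ = 0 head, MODULO its printed case-(e) residue count `hce`, threaded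
  verbatim; case tag discharged by (H.3) through `hd.v2`).
* §3 (ED. 2) (H.4) **`flickerFix_hce_of_vacuous`** — the case-(e) letter `hce` is VACUOUS (no level `m` satisfies its premises) when `N = 0 ∨ N₊ < N ∨ max N₁ N₂ ≤ N`, i.e. in
  regimes R-III, R-II (all three pairings) and the deep regimes where `(a, c)` is the weakly deeper pair or all depths agree; (H.5) **`flickerFix_natCard_fixedBy_hyp_tOne_of_vacuous`**
  — (H.2) made UNCONDITIONAL there (the printed case (e) only bites in the deep sub-regime `N < max N₁ N₂`, `N ≤ N₊`).
Sanity at regime R-III (all depths `0`): `phiOne q 0 0 = 0`, `phiZero q 0 0 0 = 1` — the hyperspecial entries `(V₀(t_ϖ), V₀(t₁)) = (0, 1)` of F0P2-p09's ★ frames ∕ counts.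
The SPECIAL column `V₁` (R-III: F0P2-p09 `R90S6FlickerLiteralCounts`; R-II: p05's R2M; R-I: rung 1 + the level-one Cayley shift) and the plug-in into 2a's shell identities are
the sequel files `R90S6TreeFixDataFlickerU3{Separated,Congruent}`.
HONEST LABEL: re-currencying of ★ Flicker closed forms, θ̄ = 0 conditional on the printed case-(e) count `hce` (the one named gap of that ★ value, carried not discharged);
count-neutral until (E1) consumes it; proves no printed global statement, discharges no citation; HC_CM is proved only modulo the 7 printed citations (2 remaining named
inputs: hLiu418 = stmt-HodgeConjecture-24832, h413 = stmt-HodgeConjecture-24833) until rung 0 closes.  REL ≠ ★ ≠ BUILT.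

## References
* [Flicker1998UnitaryFL] Y. Z. Flicker, *Elementary proof of the fundamental lemma for a unitary group*, Canad. J. Math. 50 (1998): §2 Prop. 3 pp. 78–79 (the literals
  `t₁…t₄`), §3 p. 80 (`t_θ`), Prop. 5 p. 82, Cor. 9 p. 85, Prop. 11 p. 87 (`θ̄ = 1`), Prop. 13 pp. 91–93 (case (e)), Prop. 14 p. 94 (`θ̄ = 0`), §6 p. 95.
* [Rogawski1990] J. D. Rogawski, *Automorphic Representations of Unitary Groups in Three Variables*, Ann. of Math. Stud. 123 (1990): §4.9 Prop. 4.9.1 (b) pp. 54–55.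
* [Kottwitz1986BaseChangeUnits] R. E. Kottwitz, *Base change for unit elements of Hecke algebras*, Compositio Math. 60 (1986): §3 (fixed vertices ↔ fixed cosets).
-/

set_option autoImplicit false
-- the mandated namespace repeats the single-problem summit's segment (`HodgeConjecture.HodgeConjecture`)
set_option linter.dupNamespace false

noncomputable section

open MulAction IsLocalRing
open scoped Valued WithZero Matrix MatrixGroups
open Literature.NumberTheory.Automorphic Literature.NumberTheory.Automorphic.HermitianLattice Literature.NumberTheory.Automorphic.UnitaryLatticeTree
  Literature.NumberTheory.Automorphic.UnitaryGroup
open Literature.NumberTheory.Rogawski1990.Flicker1998 (phiZero phiOne)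

namespace Summit.HodgeConjecture.HodgeConjecture.R90.S6

universe u

/-! ## §1 The two coset currencies; the θ̄ = 0 case tag -/

section Currency

variable {K : Type*} [Field K] [Valued K ℤᵐ⁰] [ValuativeRel K] [(Valued.v : Valuation K ℤᵐ⁰).Compatible] {σ : K →+* K} {N : ℕ}

/-- **(H.0) GF1's coset currency = Flicker's**: `#Fix_γ(U ⧸ (GL_N(𝒪) ⊓ U)) = #{x ∈ U ⧸ U(𝒪) : γ·x = x}` — the hyperspecial subgroup of the ★ G1 rungs,
`(glInt N K).subgroupOf U` (Mathlib's `ValuativeRel` integers), IS the `unitaryInt σ J` of the lattice ∕ Flicker files (entries of `g`, `g⁻¹` of `Valued.v ≤ 1`: ★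
`mem_glInt_iff_isIntMatrix`, ★ `mem_unitaryInt_iff`), and `fixedBy _ γ = {x | γ • x = x}` by definition. [cite: Kottwitz1986BaseChangeUnits, §3]
[cite: Flicker1998UnitaryFL, Prop. 5 p. 82] -/
theorem flickerFix_natCard_fixedBy_glInt_eq_natCard_smul_unitaryInt (J : Matrix (Fin N) (Fin N) K) (γ : ↥(unitaryGroupOfForm σ J)) :
    Nat.card (fixedBy (↥(unitaryGroupOfForm σ J) ⧸ (glInt N K).subgroupOf (unitaryGroupOfForm σ J)) γ) =
      Nat.card {x : ↥(unitaryGroupOfForm σ J) ⧸ unitaryInt σ J | γ • x = x} := by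
  have hK : (glInt N K).subgroupOf (unitaryGroupOfForm σ J) = unitaryInt σ J := by
    ext g
    rw [Subgroup.mem_subgroupOf, mem_glInt_iff_isIntMatrix, mem_unitaryInt_iff]
    rfl
  rw [hK]
  rfl

omit [ValuativeRel K] [(Valued.v : Valuation K ℤᵐ⁰).Compatible] in
/-- **(H.3) THE θ̄ = 0 CASE TAG ALWAYS HOLDS**: for a non-dyadic valuation (`|2| = 1`), a uniformising `ϖ` (`0 < |ϖ| < 1`) and depth letters `|a − c| = |ϖ^N|`,
`|a + c − 2b| = |ϖ^{N₊}|`, `|a − b| = |ϖ^{N₁}|`, `|c − b| = |ϖ^{N₂}|`: either `N₁ < N`, and then `N₂ = N₁ = N₊` (`c − b = (a − b) − (a − c)`, `a + c − 2b = 2(a − b) − (a − c)` are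
dominated by `a − b`), or `N ≤ N₁`, and then `N ≤ N₊` (`|2(a − b) − (a − c)| ≤ max ≤ |ϖ^N|`) — the disjunction `h` of ★ `natCard_fixedPoints_unitaryInt_flickerTorusOne_eq_phiZero_of_bridge`
is ultrametric bookkeeping, not a restriction. [cite: Flicker1998UnitaryFL, Prop. 14 p. 94] -/
theorem flickerFix_thetaZero_caseTag {ϖ : K} (hϖ0 : 0 < Valued.v ϖ) (hϖ1 : Valued.v ϖ < 1) (h2 : Valued.v (2 : K) = 1)
    {a b cc : K} {N Np N₁ N₂ : ℕ} (hN : Valued.v (a - cc) = Valued.v (ϖ ^ N)) (hNp : Valued.v (a + cc - 2 * b) = Valued.v (ϖ ^ Np))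
    (hN₁ : Valued.v (a - b) = Valued.v (ϖ ^ N₁)) (hN₂ : Valued.v (cc - b) = Valued.v (ϖ ^ N₂)) :
    (N₁ < N ∧ N₂ = N₁ ∧ Np = N₁) ∨ (N ≤ N₁ ∧ N ≤ Np) := by
  have hmono : StrictAnti (fun n : ℕ => Valued.v ϖ ^ n) := pow_right_strictAnti₀ hϖ0 hϖ1
  simp only [map_pow] at hN hNp hN₁ hN₂
  have h2ab : Valued.v (2 * (a - b)) = Valued.v ϖ ^ N₁ := by rw [map_mul, h2, one_mul, hN₁]
  have e1 : cc - b = (a - b) - (a - cc) := by ring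
  have e2 : a + cc - 2 * b = 2 * (a - b) - (a - cc) := by ring
  by_cases hlt : N₁ < N
  · have hlt₁ : Valued.v (a - cc) < Valued.v (a - b) := by rw [hN, hN₁]; exact hmono hlt
    have hlt₂ : Valued.v (a - cc) < Valued.v (2 * (a - b)) := by rw [hN, h2ab]; exact hmono hlt
    refine Or.inl ⟨hlt, ?_, ?_⟩
    · -- `|c − b| = |a − b|`
      have h : Valued.v (cc - b) = Valued.v ϖ ^ N₁ := by
        rw [e1, Valued.v.map_sub_eq_of_lt_left hlt₁, hN₁]
      exact StrictAnti.injective hmono (hN₂.symm.trans h)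
    · -- `|a + c − 2b| = |2(a − b)| = |a − b|`
      have h : Valued.v (a + cc - 2 * b) = Valued.v ϖ ^ N₁ := by
        rw [e2, Valued.v.map_sub_eq_of_lt_left hlt₂, h2ab]
      exact StrictAnti.injective hmono (hNp.symm.trans h)
  · rw [not_lt] at hlt
    refine Or.inr ⟨hlt, ?_⟩
    -- `|ϖ^{N₊}| = |2(a − b) − (a − c)| ≤ max(|ϖ^{N₁}|, |ϖ^N|) ≤ |ϖ^N|`
    have hle : Valued.v ϖ ^ Np ≤ Valued.v ϖ ^ N := by
      rw [← hNp, e2]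
      refine (Valuation.map_sub _ _ _).trans (max_le ?_ ?_)
      · rw [h2ab]; exact StrictAnti.antitone hmono hlt
      · rw [hN]
    by_contra hcon
    exact lt_irrefl _ ((hmono (Nat.lt_of_not_le hcon)).trans_le hle)

end Currency

/-! ## §2 The hyperspecial fixed counts of the literals `t_ϖ(a,b,c)` and `t_1(a,b,c)` from the ★ Flicker closed forms -/

section Values

variable {K : Type u} [Field K] [Valued K ℤᵐ⁰] [ValuativeRel K] [(Valued.v : Valuation K ℤᵐ⁰).Compatible]
  [IsDiscreteValuationRing (Valued.integer K)] [Finite (ResidueField (Valued.integer K))] [IsAdicComplete (maximalIdeal (Valued.integer K)) (Valued.integer K)]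
  {σ : K →+* K} {ϖ : K}

omit [Valued K ℤᵐ⁰] [ValuativeRel K] [(Valued.v : Valuation K ℤᵐ⁰).Compatible] [IsDiscreteValuationRing (Valued.integer K)]
  [Finite (ResidueField (Valued.integer K))] [IsAdicComplete (maximalIdeal (Valued.integer K)) (Valued.integer K)] in
/-- The Flicker literals `t_θ(x,y,z)` commute with `c = diag(1, −1, 1)` (both are block-diagonal for the splitting `{0,2} ⊔ {1}` of the coordinates) — the letter `htH`
of the ★ a₀ heads. [cite: Flicker1998UnitaryFL, §3 p. 80] -/
private theorem flickerFix_mem_centralizer {c γ : ↥(unitaryGroupOfForm σ ((StdForm.antidiagonal 3).over K))}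
    (hc : ((c : GL (Fin 3) K) : Matrix (Fin 3) (Fin 3) K) = !![1, 0, 0; 0, -1, 0; 0, 0, 1]) {p s m n : K}
    (hγ : ((γ : GL (Fin 3) K) : Matrix (Fin 3) (Fin 3) K) = !![p, 0, m; 0, s, 0; n, 0, p]) :
    γ ∈ Subgroup.centralizer ({c} : Set ↥(unitaryGroupOfForm σ ((StdForm.antidiagonal 3).over K))) := by
  rw [Subgroup.mem_centralizer_iff]
  intro h hh
  rw [Set.mem_singleton_iff] at hh
  subst hh
  apply Subtype.ext
  apply Units.ext
  rw [Subgroup.coe_mul, Subgroup.coe_mul, Units.val_mul, Units.val_mul, hc, hγ]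
  ext i j
  fin_cases i <;> fin_cases j <;> simp [Matrix.mul_apply, Fin.sum_univ_three]

set_option synthInstance.maxHeartbeats 200000 in
-- as in the ★ a₀ head: the `H`-action on `H ⧸ (K^{u_m} ∩ H)` is found through the large subgroup terms of the `U(2,1)` frame
/-- **(H.1) `V₀(t_ϖ(a,b,c)) = φ₁(q; N₊, N)`** — the hyperspecial fixed-coset count of Flicker's `θ̄ = 1` literal `t_ϖ(a,b,c) = !![e(a+c), 0, −e(a−c)ϖ; 0, b, 0; −e(a−c)ϖ⁻¹,
0, e(a+c)]` (the (E1) sheet's `hγ₂` bytes; `t₃ = t_ϖ(a,c,b)`, `t₄ = t_ϖ(b,a,c)` by permuting the letters) in GF1's currency: `#Fix_γ(U ⧸ (GL₃(𝒪) ⊓ U)) = phiOne q N₊ N` in `ℚ`,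
`|a − c| = |ϖ^N|`, `|a + c − 2b| = |ϖ^{N₊}|`, valid in EVERY depth regime — ★ `natCard_fixedPoints_unitaryInt_flickerTorus_eq_phiOne_of_bridge` (Flicker Prop. 5 + Cor. 9 +
Prop. 10–11 summed) read through (H.0), with its centraliser letter `htH` and finiteness letter `hfin` discharged here and the rest of the ★ a₀ frame (`LocalConjDatum`, complete
DVR integers with finite residue field, the (F3c-γ) lattice bridge `(R, ι, σR, dR, ϖR)`, `y σy = −2`, `c = diag(1,−1,1)`, `u_m`, `r_i`, `a₀`, `#𝓀 = q²`, `1 < q`) carried VERBATIM.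
R-III sanity: `phiOne q 0 0 = 0`. [cite: Flicker1998UnitaryFL, Prop. 5 p. 82; Cor. 9 p. 85; Prop. 10 pp. 85–86; Prop. 11 p. 87] [cite: Rogawski1990, §4.9 Prop. 4.9.1 (b) p. 55] -/
theorem flickerFix_natCard_fixedBy_hyp_tpi (hd : LocalConjDatum σ ϖ)
    (hσO : ∀ y : Valued.integer K, (σ.comp (Valued.integer K).subtype) y ∈ Valued.integer K) {y : K} (hy : y * σ y = -2)
    {c : ↥(unitaryGroupOfForm σ ((StdForm.antidiagonal 3).over K))} (hc : ((c : GL (Fin 3) K) : Matrix (Fin 3) (Fin 3) K) = !![1, 0, 0; 0, -1, 0; 0, 0, 1])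
    (um : ℕ → ↥(unitaryGroupOfForm σ ((StdForm.antidiagonal 3).over K)))
    (hum : ∀ m, ((um m : GL (Fin 3) K) : Matrix (Fin 3) (Fin 3) K) = !![ϖ ^ m, y, (ϖ ^ m)⁻¹; 0, 1, -σ y * (ϖ ^ m)⁻¹; 0, 0, (ϖ ^ m)⁻¹])
    {R : Type u} [CommRing R] [IsDomain R] [IsDiscreteValuationRing R] [Finite (ResidueField R)] (ι : R →+* K) (hι : Function.Injective ι)
    (hιv : ∀ x : K, Valued.v x ≤ 1 ↔ x ∈ Set.range ι) (σR : R →+* R) (hσR : ∀ r, σR (σR r) = r) (hσι : ∀ r, ι (σR r) = σ (ι r))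
    {dR : R} (hdRσ : σR dR = -dR) (hdRu : IsUnit dR) (h2R : IsUnit (2 : R)) {ϖR : R} (hϖR : Irreducible ϖR) (hιϖ : ι ϖR = ϖ)
    (r : ℕ → ↥(Subgroup.centralizer ({c} : Set ↥(unitaryGroupOfForm σ ((StdForm.antidiagonal 3).over K)))))
    (hr : ∀ i, (((r i : ↥(unitaryGroupOfForm σ ((StdForm.antidiagonal 3).over K))) : GL (Fin 3) K) : Matrix (Fin 3) (Fin 3) K) =
      !![(ϖ ^ i)⁻¹, 0, 0; 0, 1, 0; 0, 0, ϖ ^ i])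
    {q : ℕ} (hq : Nat.card (ResidueField (Valued.integer K)) = q ^ 2) (hqR : Nat.card (ResidueField R) = q ^ 2) (hq1 : 1 < q)
    {a₀ : Valued.integer K} (ha₀ : IsUnit (((σ.comp (Valued.integer K).subtype).codRestrict (Valued.integer K) hσO) a₀ - a₀))
    -- the literal `t_ϖ(a,b,c)` ((E1) sheet's `hγ₂` bytes) and its depth letters
    {e a b cc : K} (h2e : 2 * e = 1) (ha : σ a * a = 1) (hb : σ b * b = 1) (hcc : σ cc * cc = 1)
    (γ : ↥(unitaryGroupOfForm σ ((StdForm.antidiagonal 3).over K)))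
    (hγ : ((γ : GL (Fin 3) K) : Matrix (Fin 3) (Fin 3) K) = !![e * (a + cc), 0, -(e * (a - cc) * ϖ); 0, b, 0; -(e * (a - cc) * ϖ⁻¹), 0, e * (a + cc)])
    {N Np : ℕ} (hN : Valued.v (a - cc) = Valued.v (ϖ ^ N)) (hNp : Valued.v (a + cc - 2 * b) = Valued.v (ϖ ^ Np))
    [Fintype (fixedBy (↥(unitaryGroupOfForm σ ((StdForm.antidiagonal 3).over K)) ⧸
      (glInt 3 K).subgroupOf (unitaryGroupOfForm σ ((StdForm.antidiagonal 3).over K))) γ)] :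
    (Nat.card (fixedBy (↥(unitaryGroupOfForm σ ((StdForm.antidiagonal 3).over K)) ⧸
        (glInt 3 K).subgroupOf (unitaryGroupOfForm σ ((StdForm.antidiagonal 3).over K))) γ) : ℚ) = phiOne q Np N := by
  have htH := flickerFix_mem_centralizer hc hγ
  have hfin : (fixedBy (↥(unitaryGroupOfForm σ ((StdForm.antidiagonal 3).over K)) ⧸
      (glInt 3 K).subgroupOf (unitaryGroupOfForm σ ((StdForm.antidiagonal 3).over K))) γ).Finite := Set.toFinite _
  have hK : (glInt 3 K).subgroupOf (unitaryGroupOfForm σ ((StdForm.antidiagonal 3).over K)) = unitaryInt σ ((StdForm.antidiagonal 3).over K) := by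
    ext g
    rw [Subgroup.mem_subgroupOf, mem_glInt_iff_isIntMatrix, mem_unitaryInt_iff]
    rfl
  rw [hK] at hfin ⊢
  exact natCard_fixedPoints_unitaryInt_flickerTorus_eq_phiOne_of_bridge σ rfl hd hσO hy hc um hum ι hι hιv σR hσR hσι hdRσ hdRu h2R hϖR hιϖ
    h2e (pow_one ϖ).symm (by rw [pow_one]) ha hb hcc hγ htH r hr hN hNp hq hqR hq1 ha₀ hfin

set_option synthInstance.maxHeartbeats 200000 in
-- as in the ★ a₀ head: the `H`-action on `H ⧸ (K^{u_m} ∩ H)` is found through the large subgroup terms of the `U(2,1)` frame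
/-- **(H.2) `V₀(t_1(a,b,c)) = φ₀(q; N₁, N₂, N)` MODULO THE CASE-(e) COUNT** — the hyperspecial fixed-coset count of Flicker's `θ̄ = 0` literal
`t_1(a,b,c) = !![e(a+c), 0, −e(a−c); 0, b, 0; −e(a−c), 0, e(a+c)]` ((E1) sheet's `hγ₁` bytes) in GF1's currency: `#Fix_γ(U ⧸ (GL₃(𝒪) ⊓ U)) = phiZero q N₁ N₂ N` in `ℚ`,
`|a − b| = |ϖ^{N₁}|`, `|c − b| = |ϖ^{N₂}|`, `|a − c| = |ϖ^N|`, `|a + c − 2b| = |ϖ^{N₊}|`, EVERY depth regime — ★ `natCard_fixedPoints_unitaryInt_flickerTorusOne_eq_phiZero_of_bridge`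
(Flicker Prop. 5 + Cor. 9 + Prop. 10∕13 + Prop. 14 summed) read through (H.0); its case tag `h` is discharged by (H.3) (`|2| = 1` from `hd.v2`), `htH` and `hfin` as in (H.1); its ONE
named gap — the printed case-(e) residue count `hce` [Flicker Prop. 13 pp. 91–93] — is carried VERBATIM (not discharged here), together with the ★ a₀ frame.
R-III sanity: `phiZero q 0 0 0 = 1`. [cite: Flicker1998UnitaryFL, Prop. 5 p. 82; Cor. 9 p. 85; Prop. 13 pp. 91–93; Prop. 14 p. 94] [cite: Rogawski1990, §4.9 Prop. 4.9.1 (b) p. 55] -/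
theorem flickerFix_natCard_fixedBy_hyp_tOne (hd : LocalConjDatum σ ϖ)
    (hσO : ∀ y : Valued.integer K, (σ.comp (Valued.integer K).subtype) y ∈ Valued.integer K) {y : K} (hy : y * σ y = -2)
    {c : ↥(unitaryGroupOfForm σ ((StdForm.antidiagonal 3).over K))} (hc : ((c : GL (Fin 3) K) : Matrix (Fin 3) (Fin 3) K) = !![1, 0, 0; 0, -1, 0; 0, 0, 1])
    (um : ℕ → ↥(unitaryGroupOfForm σ ((StdForm.antidiagonal 3).over K)))
    (hum : ∀ m, ((um m : GL (Fin 3) K) : Matrix (Fin 3) (Fin 3) K) = !![ϖ ^ m, y, (ϖ ^ m)⁻¹; 0, 1, -σ y * (ϖ ^ m)⁻¹; 0, 0, (ϖ ^ m)⁻¹])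
    {R : Type u} [CommRing R] [IsDomain R] [IsDiscreteValuationRing R] [Finite (ResidueField R)] (ι : R →+* K) (hι : Function.Injective ι)
    (hιv : ∀ x : K, Valued.v x ≤ 1 ↔ x ∈ Set.range ι) (σR : R →+* R) (hσR : ∀ r, σR (σR r) = r) (hσι : ∀ r, ι (σR r) = σ (ι r))
    {dR : R} (hdRσ : σR dR = -dR) (hdRu : IsUnit dR) (h2R : IsUnit (2 : R)) {ϖR : R} (hϖR : Irreducible ϖR) (hιϖ : ι ϖR = ϖ)
    (r : ℕ → ↥(Subgroup.centralizer ({c} : Set ↥(unitaryGroupOfForm σ ((StdForm.antidiagonal 3).over K)))))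
    (hr : ∀ i, (((r i : ↥(unitaryGroupOfForm σ ((StdForm.antidiagonal 3).over K))) : GL (Fin 3) K) : Matrix (Fin 3) (Fin 3) K) =
      !![(ϖ ^ i)⁻¹, 0, 0; 0, 1, 0; 0, 0, ϖ ^ i])
    {q : ℕ} (hqR : Nat.card (ResidueField R) = q ^ 2) (hq : Nat.card (ResidueField (Valued.integer K)) = q ^ 2)
    {a₀ : Valued.integer K} (ha₀ : IsUnit (((σ.comp (Valued.integer K).subtype).codRestrict (Valued.integer K) hσO) a₀ - a₀))
    -- the literal `t_1(a,b,c)` ((E1) sheet's `hγ₁` bytes) and its depth letters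
    {e a b cc : K} (h2e : 2 * e = 1) (ha : σ a * a = 1) (hb : σ b * b = 1) (hcc : σ cc * cc = 1)
    (γ : ↥(unitaryGroupOfForm σ ((StdForm.antidiagonal 3).over K)))
    (hγ : ((γ : GL (Fin 3) K) : Matrix (Fin 3) (Fin 3) K) = !![e * (a + cc), 0, -(e * (a - cc)); 0, b, 0; -(e * (a - cc)), 0, e * (a + cc)])
    {N Np N₁ N₂ : ℕ} (hN : Valued.v (a - cc) = Valued.v (ϖ ^ N)) (hNp : Valued.v (a + cc - 2 * b) = Valued.v (ϖ ^ Np))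
    (hN₁ : Valued.v (a - b) = Valued.v (ϖ ^ N₁)) (hN₂ : Valued.v (cc - b) = Valued.v (ϖ ^ N₂))
    -- the printed case-(e) residue count (the one named gap of the ★ θ̄ = 0 value), VERBATIM
    (hce : ∀ m, N < m → N ≤ Np → max N₁ N₂ < 2 * m → 2 * m ≤ max N₁ N₂ + N → (max N₁ N₂ - N) % 2 = 0 →
      (∀ p ∈ flickerPH σ ((StdForm.antidiagonal 3).over K) c, ∀ u' x w : K,
        ((p : GL (Fin 3) K) : Matrix (Fin 3) (Fin 3) K) = !![u', 0, u' * x; 0, w, 0; 0, 0, (σ u')⁻¹] →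
          (p⁻¹ * γ * p ∈ flickerHK σ ((StdForm.antidiagonal 3).over K) c (um m) ↔
            Valued.v (((u' * σ u')⁻¹ + -(e * ((a + cc - 2 * b) / (a - cc) + σ ((a + cc - 2 * b) / (a - cc)))) + x) *
                σ ((u' * σ u')⁻¹ + -(e * ((a + cc - 2 * b) / (a - cc) + σ ((a + cc - 2 * b) / (a - cc)))) + x) -
              ((-(e * ((a + cc - 2 * b) / (a - cc) + σ ((a + cc - 2 * b) / (a - cc))))) ^ 2 - 1)) ≤ Valued.v (ϖ ^ (2 * m - N)))) →
      Nat.card {w : ↥(flickerPH σ ((StdForm.antidiagonal 3).over K) c) ⧸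
          (flickerHK σ ((StdForm.antidiagonal 3).over K) c (um m)).subgroupOf (flickerPH σ ((StdForm.antidiagonal 3).over K) c) //
        ((Quotient.out w : ↥(flickerPH σ ((StdForm.antidiagonal 3).over K) c)) : ↥(unitaryGroupOfForm σ ((StdForm.antidiagonal 3).over K)))⁻¹ * γ *
            (Quotient.out w : ↥(flickerPH σ ((StdForm.antidiagonal 3).over K) c)) ∈ flickerHK σ ((StdForm.antidiagonal 3).over K) c (um m)} =
        (q + 1) ^ 2 * q ^ (2 * m + N - 2))
    [Fintype (fixedBy (↥(unitaryGroupOfForm σ ((StdForm.antidiagonal 3).over K)) ⧸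
      (glInt 3 K).subgroupOf (unitaryGroupOfForm σ ((StdForm.antidiagonal 3).over K))) γ)] :
    (Nat.card (fixedBy (↥(unitaryGroupOfForm σ ((StdForm.antidiagonal 3).over K)) ⧸
        (glInt 3 K).subgroupOf (unitaryGroupOfForm σ ((StdForm.antidiagonal 3).over K))) γ) : ℚ) = phiZero q N₁ N₂ N := by
  have htH := flickerFix_mem_centralizer hc hγ
  have hfin : (fixedBy (↥(unitaryGroupOfForm σ ((StdForm.antidiagonal 3).over K)) ⧸
      (glInt 3 K).subgroupOf (unitaryGroupOfForm σ ((StdForm.antidiagonal 3).over K))) γ).Finite := Set.toFinite _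
  have hK : (glInt 3 K).subgroupOf (unitaryGroupOfForm σ ((StdForm.antidiagonal 3).over K)) = unitaryInt σ ((StdForm.antidiagonal 3).over K) := by
    ext g
    rw [Subgroup.mem_subgroupOf, mem_glInt_iff_isIntMatrix, mem_unitaryInt_iff]
    rfl
  -- the case tag from the depth letters (`|2| = 1`, `0 < |ϖ| < 1`)
  have hϖ0 : 0 < Valued.v ϖ := by rw [hd.vϖ]; exact WithZero.exp_pos
  have hϖ1 : Valued.v ϖ < 1 := by rw [hd.vϖ, ← WithZero.exp_zero]; exact WithZero.exp_lt_exp.2 (by norm_num)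
  have h := flickerFix_thetaZero_caseTag hϖ0 hϖ1 hd.v2 hN hNp hN₁ hN₂
  rw [hK] at hfin ⊢
  exact natCard_fixedPoints_unitaryInt_flickerTorusOne_eq_phiZero_of_bridge σ rfl hd hσO hy hc um hum ι hι hιv σR hσR hσι hdRσ hdRu h2R hϖR hιϖ
    hqR hq ha₀ h2e ha hb hcc hγ htH r hr hN hNp hN₁ hN₂ h hce hfin

end Values

/-! ## §3 (ED. 2) The case-(e) count is VACUOUS outside the deep sub-regime «`b` in the deeper pair»: `V₀(t₁)` unconditionally there -/

section Vacuous

/-- **(H.4) WHEN THE CASE-(e) HYPOTHESIS IS VACUOUS.**  The printed case-(e) count `hce` of the ★ θ̄ = 0 closed form quantifies over levels `m` with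
`N < m`, `N ≤ N₊`, `max N₁ N₂ < 2m ≤ max N₁ N₂ + N` (and a parity): NO such `m` exists as soon as `N = 0` (the plane eigenvalues `a, c` residually separated: regimes R-III,
R-II(a≡b), R-II(b≡c)), or `N₊ < N` (the case `N₁ < N` of (H.3): regime R-II(a≡c) and the deep regime with `(a, c)` the deeper pair), or `max N₁ N₂ ≤ N` (all three depths
equal) — then `hce` holds for ANY conclusion `P m`; the case (e) [Flicker Prop. 13] only bites in the deep sub-regime `N = min < max N₁ N₂` («`b` in the deeper pair»).
Pure `ℕ`-arithmetic. [cite: Flicker1998UnitaryFL, Prop. 13 pp. 91–93; Prop. 14 p. 94] -/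
theorem flickerFix_hce_of_vacuous {N Np N₁ N₂ : ℕ} (hvac : N = 0 ∨ Np < N ∨ max N₁ N₂ ≤ N) {P : ℕ → Prop} :
    ∀ m : ℕ, N < m → N ≤ Np → max N₁ N₂ < 2 * m → 2 * m ≤ max N₁ N₂ + N → (max N₁ N₂ - N) % 2 = 0 → P m := by
  intro m h1 h2 h3 h4 _
  exfalso
  omega

variable {K : Type u} [Field K] [Valued K ℤᵐ⁰] [ValuativeRel K] [(Valued.v : Valuation K ℤᵐ⁰).Compatible]
  [IsDiscreteValuationRing (Valued.integer K)] [Finite (ResidueField (Valued.integer K))] [IsAdicComplete (maximalIdeal (Valued.integer K)) (Valued.integer K)]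
  {σ : K →+* K} {ϖ : K}

set_option synthInstance.maxHeartbeats 200000 in
-- as in the ★ a₀ head: the `H`-action on `H ⧸ (K^{u_m} ∩ H)` is found through the large subgroup terms of the `U(2,1)` frame
/-- **(H.5) `V₀(t_1(a,b,c)) = φ₀(q; N₁, N₂, N)` UNCONDITIONALLY outside the sub-regime «`b` in the deeper pair»**: (H.2) with its case-(e) letter `hce` DISCHARGED by (H.4)
under `N = 0 ∨ N₊ < N ∨ max N₁ N₂ ≤ N` — i.e. in regimes R-III (`N = N₁ = N₂ = 0`), R-II for every pairing (`a≡b` or `b≡c`: `N = 0`; `a≡c`: `N₊ = N₁ = 0 < N` by (H.3)), and the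
deep regimes with `(a, c)` the (weakly) deeper pair or all depths equal; the rest of the ★ a₀ frame as in (H.2).  So the hyperspecial column of `t₁` is an unconditional closed form
everywhere except the deep sub-regime `v(a−c) < v(a−b) = v(c−b)`-type data… precisely `N < max N₁ N₂` with `N ≤ N₊`, where the printed case-(e) residue count remains the one
named input. [cite: Flicker1998UnitaryFL, Prop. 5 p. 82; Cor. 9 p. 85; Prop. 14 p. 94] [cite: Rogawski1990, §4.9 Prop. 4.9.1 (b) p. 55] -/
theorem flickerFix_natCard_fixedBy_hyp_tOne_of_vacuous (hd : LocalConjDatum σ ϖ)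
    (hσO : ∀ y : Valued.integer K, (σ.comp (Valued.integer K).subtype) y ∈ Valued.integer K) {y : K} (hy : y * σ y = -2)
    {c : ↥(unitaryGroupOfForm σ ((StdForm.antidiagonal 3).over K))} (hc : ((c : GL (Fin 3) K) : Matrix (Fin 3) (Fin 3) K) = !![1, 0, 0; 0, -1, 0; 0, 0, 1])
    (um : ℕ → ↥(unitaryGroupOfForm σ ((StdForm.antidiagonal 3).over K)))
    (hum : ∀ m, ((um m : GL (Fin 3) K) : Matrix (Fin 3) (Fin 3) K) = !![ϖ ^ m, y, (ϖ ^ m)⁻¹; 0, 1, -σ y * (ϖ ^ m)⁻¹; 0, 0, (ϖ ^ m)⁻¹])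
    {R : Type u} [CommRing R] [IsDomain R] [IsDiscreteValuationRing R] [Finite (ResidueField R)] (ι : R →+* K) (hι : Function.Injective ι)
    (hιv : ∀ x : K, Valued.v x ≤ 1 ↔ x ∈ Set.range ι) (σR : R →+* R) (hσR : ∀ r, σR (σR r) = r) (hσι : ∀ r, ι (σR r) = σ (ι r))
    {dR : R} (hdRσ : σR dR = -dR) (hdRu : IsUnit dR) (h2R : IsUnit (2 : R)) {ϖR : R} (hϖR : Irreducible ϖR) (hιϖ : ι ϖR = ϖ)
    (r : ℕ → ↥(Subgroup.centralizer ({c} : Set ↥(unitaryGroupOfForm σ ((StdForm.antidiagonal 3).over K)))))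
    (hr : ∀ i, (((r i : ↥(unitaryGroupOfForm σ ((StdForm.antidiagonal 3).over K))) : GL (Fin 3) K) : Matrix (Fin 3) (Fin 3) K) =
      !![(ϖ ^ i)⁻¹, 0, 0; 0, 1, 0; 0, 0, ϖ ^ i])
    {q : ℕ} (hqR : Nat.card (ResidueField R) = q ^ 2) (hq : Nat.card (ResidueField (Valued.integer K)) = q ^ 2)
    {a₀ : Valued.integer K} (ha₀ : IsUnit (((σ.comp (Valued.integer K).subtype).codRestrict (Valued.integer K) hσO) a₀ - a₀))
    {e a b cc : K} (h2e : 2 * e = 1) (ha : σ a * a = 1) (hb : σ b * b = 1) (hcc : σ cc * cc = 1)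
    (γ : ↥(unitaryGroupOfForm σ ((StdForm.antidiagonal 3).over K)))
    (hγ : ((γ : GL (Fin 3) K) : Matrix (Fin 3) (Fin 3) K) = !![e * (a + cc), 0, -(e * (a - cc)); 0, b, 0; -(e * (a - cc)), 0, e * (a + cc)])
    {N Np N₁ N₂ : ℕ} (hN : Valued.v (a - cc) = Valued.v (ϖ ^ N)) (hNp : Valued.v (a + cc - 2 * b) = Valued.v (ϖ ^ Np))
    (hN₁ : Valued.v (a - b) = Valued.v (ϖ ^ N₁)) (hN₂ : Valued.v (cc - b) = Valued.v (ϖ ^ N₂))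
    (hvac : N = 0 ∨ Np < N ∨ max N₁ N₂ ≤ N)
    [Fintype (fixedBy (↥(unitaryGroupOfForm σ ((StdForm.antidiagonal 3).over K)) ⧸
      (glInt 3 K).subgroupOf (unitaryGroupOfForm σ ((StdForm.antidiagonal 3).over K))) γ)] :
    (Nat.card (fixedBy (↥(unitaryGroupOfForm σ ((StdForm.antidiagonal 3).over K)) ⧸
        (glInt 3 K).subgroupOf (unitaryGroupOfForm σ ((StdForm.antidiagonal 3).over K))) γ) : ℚ) = phiZero q N₁ N₂ N :=
  flickerFix_natCard_fixedBy_hyp_tOne hd hσO hy hc um hum ι hι hιv σR hσR hσι hdRσ hdRu h2R hϖR hιϖ r hr hqR hq ha₀ h2e ha hb hcc γ hγ hN hNp hN₁ hN₂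
    (flickerFix_hce_of_vacuous hvac)

end Vacuous

end Summit.HodgeConjecture.HodgeConjecture.R90.S6

end
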